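import Summits.QuantumAdvantage.QuantumAdvantage.Theses.CompactnessLift
import Literature.Computability.Complexity.RelativizedTime
import Literature.Computability.Complexity.NTIMEMono
import Literature.Computability.QuantumComplexity.BQTime

/-!
# `LanguageLadder` (crux stmt-QuantumAdvantage-15271, route `CompactnessLift`) — the additive slack
# of the description budget is load-bearing, and only through `n = 0`

Negative-side lemma (`_false_without_` analysis) extracted from the disprover work file
`Summits/QuantumAdvantage/QuantumAdvantage/Cruxes/LanguageLadder/Disproof.lean` §4(a)
(refuter-cdisprove-stmt-QuantumAdvantage-15271-0, cycle 1). Sorry-free; axioms ⊆ {propext,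
Classical.choice, Quot.sound}; no statement of the route is asserted positively and no definition is
introduced (the slack-free witness class is written out as `⋃ C, BQTimeUniform (fun n => C * n ^ 2)`).

The crux `LanguageLadder := ∀ c, ∃ L ∈ BQTime (·^2), L ∉ bp (DTIME (·^c))` draws its witnesses from
`BQTime (·^2) = ⋃ C, BQTimeUniform (fun n => C * n ^ 2 + C)` (`BQTime_eq_iUnion`). Drop the `+ C`:

* a ZERO-STEP run of a Mathlib `TM2` machine is impossible — `initList` carries the label
  `some main`, `haltList` the label `none` (tree `Literature.Computability.Complexity.not_outputsWithin_zero`,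
  `NTIMEMono.lean`, reused);
* hence no function is `TimeComputable` with a clock vanishing at an occurring input length
  (`not_timeComputable_of_apply_eq_zero`), every exact quantum class `BQTimeUniform t` with
  `t 0 = 0` is EMPTY (`BQTimeUniform_eq_empty_of_apply_zero`) — and so is every exact classical class
  `TimeClass t` with `t 0 = 0` (`timeClass_eq_empty_of_apply_zero`: the `+ c` of
  `DTIME t = {L | ∃ c, L ∈ TimeClass (c * t · + c)}` is load-bearing in exactly the same way);
* so the slack-free ladder is FALSE (`languageLadder_false_without_slack`), for the degenerate reason
  that its witness class is empty; the same holds for the refuter-repaired ladder over `BPTime`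
  (`languageLadderR_false_without_slack`).

Reading for provers/planners: any proof of the crux uses the additive constant exactly once, at the
empty input; any restatement must keep an additive constant in the description budget (or clock
from `n ≥ 1`). This is an artefact boundary, not evidence against the crux.
-/

set_option linter.dupNamespace false

namespace Summit.QuantumAdvantage.QuantumAdvantage.Theorems.LanguageLadder.Negative

open Literature.Computability.Complexity Literature.Computability.QuantumComplexity
  Literature.Computability.Cryptography Turing Function

/-- No function is computable with a clock that vanishes at some input length that occurs.
[folklore] -/
theorem not_timeComputable_of_apply_eq_zero {α β Γ₀ Γ₁ : Type} {ea : α → List Γ₀} {eb : β → List Γ₁}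
    {f : α → β} {t : ℕ → ℕ} (a : α) (ht : t (ea a).length = 0) : ¬ TimeComputable ea eb f t := by
  rintro ⟨M, hM⟩
  have h : M.OutputsWithin (ea a) (eb (f a)) (t (ea a).length) := hM a
  rw [ht] at h
  exact not_outputsWithin_zero M _ _ h

/-- **Exact quantum classes with `t 0 = 0` are empty** (the description of the length-`0` circuit
must be written in `0` steps). In particular `BQTimeUniform (fun n => C * n ^ 2) = ∅` for every `C`:
the slack `+ C` in `BQTime`/`QuadQ` is what lets `n = 0` through. [folklore] -/
theorem BQTimeUniform_eq_empty_of_apply_zero {t : ℕ → ℕ} (ht : t 0 = 0) : BQTimeUniform t = ∅ := by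
  ext L
  simp only [Set.mem_empty_iff_false, iff_false]
  rintro ⟨F, -, hT, -⟩
  exact not_timeComputable_of_apply_eq_zero (ea := Computability.unaryEncodeNat) 0
    (by simpa [Computability.unaryEncodeNat] using ht) hT

/-- The same artefact on the classical side: `TimeClass t = ∅` whenever `t 0 = 0` (a decider must
write its answer bit on the empty input); so the `+ c` of `DTIME t = ⋃ c, TimeClass (c * t · + c)` is
load-bearing in the same (and only in this) way. [folklore] -/
theorem timeClass_eq_empty_of_apply_zero {t : ℕ → ℕ} (ht : t 0 = 0) : TimeClass t = ∅ := by
  ext L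
  simp only [Set.mem_empty_iff_false, iff_false]
  rintro ⟨M, hM⟩
  have h := hM []
  simp only [id_eq, List.length_nil, ht] at h
  exact not_outputsWithin_zero M _ _ h

/-- The slack-free witness class `⋃ C, BQTimeUniform (C * n ^ 2)` (i.e. `QuadQ` with budget
`C * n ^ 2` instead of `C * n ^ 2 + C`) is empty. [folklore] -/
theorem iUnion_BQTimeUniform_mul_sq_eq_empty :
    (⋃ C : ℕ, BQTimeUniform fun n => C * n ^ 2) = ∅ := by
  simp [BQTimeUniform_eq_empty_of_apply_zero]

/-- **`_false_without_` — without the additive slack the ladder is FALSE**, because its witness class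
is empty (`n = 0`). Any proof of the crux uses the `+ C` exactly once, at `n = 0`; any repair must
keep an additive constant (or start the clock at `n ≥ 1`). [folklore] -/
theorem languageLadder_false_without_slack :
    ¬ (∀ c : ℕ, ∃ L ∈ (⋃ C : ℕ, BQTimeUniform fun n => C * n ^ 2), L ∉ bp (DTIME fun n => n ^ c)) := by
  intro h
  obtain ⟨L, hL, -⟩ := h 0
  rw [iUnion_BQTimeUniform_mul_sq_eq_empty] at hL
  exact hL

/-- The same artefact bites the refuter-repaired ladder over the honest classes `BPTime (·^c)`
(its witness class is the same `BQTime (·^2)`). [folklore] -/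
theorem languageLadderR_false_without_slack :
    ¬ (∀ c : ℕ, ∃ L ∈ (⋃ C : ℕ, BQTimeUniform fun n => C * n ^ 2), L ∉ BPTime (fun n => n ^ c)) := by
  intro h
  obtain ⟨L, hL, -⟩ := h 0
  rw [iUnion_BQTimeUniform_mul_sq_eq_empty] at hL
  exact hL

end Summit.QuantumAdvantage.QuantumAdvantage.Theorems.LanguageLadder.Negative
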